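import Summits.CriticalPhenomena.PercolationContinuityZ3.Theorems.PercNearOneGluingNoHeavyLowerTailThreePointProductFormFibreFlat
import HarnessLib

/-!
# The product form `#bad² ≤ #P1·#P2` in the fibre language: THE ANTITHETIC (♭-FREE) FORM OF `bad`
# (Sahi programme, prover prim-sahi-p2 gen 54)

Support file (`--supports stmt-CriticalPhenomena-4575`, helper); continues `…ThreePointProductFormFibreFlat`.  Standard axioms, no sorries,
no named facts, no definitions.  Memo `run/shared/lean/prim/prim-sahi/FROM-prim-sahi-p2-gen54-CERTIFICATE-SHAPE.md` §0 (3‴) and PROOF-E3 (64q).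

With `R z x y` = open connection in the labelled multigraph `(V, α, ends)` at the configuration `z : α → Bool`, `z̄ = fun l => !z l` the
complementary (ANTITHETIC) configuration and `♭z = clusterFlip ends a z̄` the flat of the apex `a`:
* `reachable_compl_flat_iff` [this work] — the apex cluster of `(♭z)̄` is the apex cluster of `z` (`μ_a` preserves the closed cluster of `a`,
  `creach_clusterFlip_iff` of `…ThreePointCPIClusterSwap`).
* **`card_filter_flat_eq_card_filter_compl`** [this work] — ♭-TRANSITIONS OUT OF AN APEX-CLUSTER CLASS ARE COMPLEMENT TRANSITIONS: for every
  class `A` of configurations determined by the apex cluster (by the predicate `v ↦ R z a v`) and every class `Y`,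
  `#{z : A z ∧ Y (♭z)} = #{w : Y w ∧ A w̄}` (bijection `z ↦ ♭z`, inverse `w ↦ (μ_a w)̄`).  Hence (`card_filter_flat_symm`) the ♭-transition
  counts between two apex-cluster classes are SYMMETRIC, e.g. `#{P1 → J} = #{J → P1}` for the types `J, P1, P2, D` of the three-point problem.
* `reachable_flat_of_reachable` [this work] — a connection `u ↔ w` of `z` avoiding the apex cluster survives the flat (`P3` is ♭-stable).
* **`card_bad_add_card_eq_card_antithetic`** [this work] — THE ♭-FREE FORM OF `bad`:
  `#bad + #{z : a ↮ s, a ↮ c, s ↔ c in z} = #{w : s ↔ c in w and a ↮ s, a ↮ c in w̄}`,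
  i.e. `#bad = #{(w, w̄) : s ↔ c in w, the apex separated from both terminals in the complement} − #P3`; so CONJECTURE (P) reads, without ♭,
  `(#{w : s ↔_w c, a ↮_{w̄} s, a ↮_{w̄} c} − #{w : s ↔_w c, a ↮_w s, a ↮_w c})² ≤ #{a ↔ s, a ↮ c} · #{a ↔ c, a ↮ s}` (`productForm_iff_antithetic`).
[folklore] (involutions give bijections of finite sets); [cite: Gladkov2024, Conjecture 10.1 (p. 18), arXiv:2408.08457] for (P).
-/

namespace Summit.CriticalPhenomena.PercolationContinuityZ3.Theorems.ProductFormFibre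

open Finset Literature.Probability.Percolation
open Summit.CriticalPhenomena.PercolationContinuityZ3.Theorems.ThreePointCPIClusterSwap
  (CReach QTouch clusterFlip clusterFlip_of_qtouch clusterFlip_of_not_qtouch clusterFlip_clusterFlip creach_clusterFlip_iff)

variable {V α : Type*}

section Antithetic

variable (ends : α → Sym2 V) (a : V)

/-- Double complementation of a labelled configuration is the identity. [folklore] -/
theorem compl_compl_conf (z : α → Bool) : (fun l => !(fun l' => !z l') l) = z := by
  funext l
  simp only [Bool.not_not]

/-- **The apex cluster of the complement of `♭z` is the apex cluster of `z`** (`μ_a` preserves the closed cluster of `a`). [this work] -/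
theorem reachable_compl_flat_iff (z : α → Bool) (v : V) :
    (openGraph (labelledOpen ends fun l => !(clusterFlip ends a (fun l' => !z l')) l)).Reachable a v ↔
      (openGraph (labelledOpen ends z)).Reachable a v := by
  have h := creach_clusterFlip_iff ends a (fun l' => !z l') v
  simp only [CReach, Bool.not_not] at h
  exact h

/-- `μ_a` of the double complement: `♭((μ_a w)̄) = w`. [this work] -/
theorem flat_compl_clusterFlip (w : α → Bool) :
    clusterFlip ends a (fun l => !(fun l' => !(clusterFlip ends a w) l') l) = w := by
  rw [compl_compl_conf (clusterFlip ends a w), clusterFlip_clusterFlip]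

/-- A label none of whose endpoints lies in the apex cluster keeps its value under the flat. [this work] -/
theorem flat_apply_of_not_reachable (z : α → Bool) {l : α}
    (h : ∀ v ∈ ends l, ¬ (openGraph (labelledOpen ends z)).Reachable a v) :
    clusterFlip ends a (fun l' => !z l') l = z l := by
  have hq : ¬ QTouch ends a (fun l' => !z l') l := by
    rintro ⟨v, hv, hr⟩
    apply h v hv
    simp only [CReach, Bool.not_not] at hr
    exact hr
  rw [clusterFlip_of_not_qtouch ends a _ hq, Bool.not_not]

/-- A walk of `z` starting outside the apex cluster is a walk of `♭z`. [this work] -/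
theorem reachable_flat_of_walk (z : α → Bool) :
    ∀ {u w : V} (_ : (openGraph (labelledOpen ends z)).Walk u w),
      ¬ (openGraph (labelledOpen ends z)).Reachable a u →
      (openGraph (labelledOpen ends (clusterFlip ends a fun l => !z l))).Reachable u w
  | _, _, .nil, _ => SimpleGraph.Reachable.refl _
  | u, w, .cons (v := x) hadj p, hu => by
      have hx : ¬ (openGraph (labelledOpen ends z)).Reachable a x :=
        fun hx => hu (hx.trans hadj.reachable.symm)
      have hadj' : (openGraph (labelledOpen ends (clusterFlip ends a fun l => !z l))).Adj u x := by
        rw [openGraph_adj] at hadj ⊢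
        obtain ⟨⟨l, hl, hle⟩, hux⟩ := hadj
        refine ⟨⟨l, ?_, hle⟩, hux⟩
        rw [flat_apply_of_not_reachable ends a z (l := l) ?_]
        · exact hl
        · intro v hv
          rw [hle, Sym2.mem_iff] at hv
          rcases hv with rfl | rfl
          · exact hu
          · exact hx
      exact hadj'.reachable.trans (reachable_flat_of_walk z p hx)

/-- **`P3` is ♭-stable**: a connection `u ↔ w` of `z` with `u` outside the apex cluster survives the flat. [this work] -/
theorem reachable_flat_of_reachable (z : α → Bool) {u w : V}
    (hu : ¬ (openGraph (labelledOpen ends z)).Reachable a u) (h : (openGraph (labelledOpen ends z)).Reachable u w) :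
    (openGraph (labelledOpen ends (clusterFlip ends a fun l => !z l))).Reachable u w := by
  obtain ⟨p⟩ := h
  exact reachable_flat_of_walk ends a z p hu

variable [Fintype α] [DecidableEq α]

/-- **♭-transitions out of an apex-cluster class are complement transitions.**  If the class `A` of configurations depends only on the
apex cluster (`hA`), then for every class `Y`: `#{z : A z ∧ Y (♭z)} = #{w : Y w ∧ A w̄}` — the bijection is `z ↦ ♭z` with inverse
`w ↦ (μ_a w)̄`; `A` transfers because the apex cluster of `(♭z)̄` is that of `z`. [this work] -/
theorem card_filter_flat_eq_card_filter_compl (A Y : (α → Bool) → Prop) [DecidablePred A] [DecidablePred Y]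
    (hA : ∀ z z' : α → Bool,
      (∀ v, (openGraph (labelledOpen ends z)).Reachable a v ↔ (openGraph (labelledOpen ends z')).Reachable a v) → (A z ↔ A z')) :
    (univ.filter fun z : α → Bool => A z ∧ Y (clusterFlip ends a fun l => !z l)).card =
    (univ.filter fun w : α → Bool => Y w ∧ A (fun l => !w l)).card := by
  refine Finset.card_bij' (fun z _ => clusterFlip ends a fun l => !z l)
    (fun w _ => fun l => !(clusterFlip ends a w) l) ?_ ?_ ?_ ?_
  · intro z hz
    rw [Finset.mem_filter] at hz ⊢
    exact ⟨Finset.mem_univ _, hz.2.2, (hA _ _ (fun v => reachable_compl_flat_iff ends a z v)).2 hz.2.1⟩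
  · intro w hw
    rw [Finset.mem_filter] at hw ⊢
    refine ⟨Finset.mem_univ _, ?_, ?_⟩
    · refine (hA (fun l => !(clusterFlip ends a w) l) (fun l => !w l) (fun v => ?_)).2 hw.2.2
      have h := creach_clusterFlip_iff ends a w v
      simp only [CReach] at h
      exact h
    · rw [flat_compl_clusterFlip ends a w]
      exact hw.2.1
  · intro z _
    show (fun l => !(clusterFlip ends a (clusterFlip ends a fun l' => !z l')) l) = z
    rw [clusterFlip_clusterFlip]
    exact compl_compl_conf z
  · intro w _
    exact flat_compl_clusterFlip ends a w

/-- Swapping the roles of a configuration and its complement does not change a joint count. [folklore] -/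
theorem card_filter_compl_swap (P Q : (α → Bool) → Prop) [DecidablePred P] [DecidablePred Q] :
    (univ.filter fun w : α → Bool => P w ∧ Q (fun l => !w l)).card =
    (univ.filter fun w : α → Bool => Q w ∧ P (fun l => !w l)).card := by
  refine Finset.card_bij' (fun w _ => fun l => !w l) (fun w _ => fun l => !w l) ?_ ?_ ?_ ?_
  · intro w hw
    rw [Finset.mem_filter] at hw ⊢
    exact ⟨Finset.mem_univ _, hw.2.2, by rw [compl_compl_conf w]; exact hw.2.1⟩
  · intro w hw
    rw [Finset.mem_filter] at hw ⊢
    exact ⟨Finset.mem_univ _, hw.2.2, by rw [compl_compl_conf w]; exact hw.2.1⟩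
  · intro w _
    exact compl_compl_conf w
  · intro w _
    exact compl_compl_conf w

/-- **The ♭-transition counts between apex-cluster classes are symmetric**: `#{z : A z, B (♭z)} = #{z : B z, A (♭z)}` whenever `A` and `B`
depend only on the apex cluster (e.g. the types `J = {a ↔ s, a ↔ c}`, `P1 = {a ↔ s, a ↮ c}`, `P2`, `D = {a ↮ s, a ↮ c}`). [this work] -/
theorem card_filter_flat_symm (A B : (α → Bool) → Prop) [DecidablePred A] [DecidablePred B]
    (hA : ∀ z z' : α → Bool,
      (∀ v, (openGraph (labelledOpen ends z)).Reachable a v ↔ (openGraph (labelledOpen ends z')).Reachable a v) → (A z ↔ A z'))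
    (hB : ∀ z z' : α → Bool,
      (∀ v, (openGraph (labelledOpen ends z)).Reachable a v ↔ (openGraph (labelledOpen ends z')).Reachable a v) → (B z ↔ B z')) :
    (univ.filter fun z : α → Bool => A z ∧ B (clusterFlip ends a fun l => !z l)).card =
    (univ.filter fun z : α → Bool => B z ∧ A (clusterFlip ends a fun l => !z l)).card := by
  rw [card_filter_flat_eq_card_filter_compl ends a A B hA, card_filter_flat_eq_card_filter_compl ends a B A hB]
  exact card_filter_compl_swap B A

open Classical in
/-- **THE ♭-FREE (ANTITHETIC) FORM OF `bad`.**  For every finite labelled multigraph and all `a s c`: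
`#bad + #{z : a ↮ s, a ↮ c, s ↔ c in z} = #{w : s ↔ c in w, and a ↮ s, a ↮ c in the complement w̄}`
(`bad = {a ↮ s, a ↮ c, s ↮ c in z, s ↔ c in ♭z}`).  Proof: `{a ↮ s, a ↮ c, s ↔ c} ⊆ {s ↔ c in ♭z}` (`reachable_flat_of_reachable`), so the
left side counts `{z : a ↮_z s, a ↮_z c, s ↔_{♭z} c}`, which `card_filter_flat_eq_card_filter_compl` identifies with the right side. [this work] -/
theorem card_bad_add_card_eq_card_antithetic (ends : α → Sym2 V) (a s c : V) :
    (univ.filter fun z : α → Bool =>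
        (¬ (openGraph (labelledOpen ends z)).Reachable a s ∧ ¬ (openGraph (labelledOpen ends z)).Reachable a c ∧
          ¬ (openGraph (labelledOpen ends z)).Reachable s c) ∧
        (openGraph (labelledOpen ends (clusterFlip ends a fun l => !z l))).Reachable s c).card +
    (univ.filter fun z : α → Bool =>
        ¬ (openGraph (labelledOpen ends z)).Reachable a s ∧ ¬ (openGraph (labelledOpen ends z)).Reachable a c ∧
          (openGraph (labelledOpen ends z)).Reachable s c).card =
    (univ.filter fun w : α → Bool =>
        (openGraph (labelledOpen ends w)).Reachable s c ∧
        (¬ (openGraph (labelledOpen ends fun l => !w l)).Reachable a s ∧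
          ¬ (openGraph (labelledOpen ends fun l => !w l)).Reachable a c)).card := by
  have h1 : (univ.filter fun z : α → Bool =>
        (¬ (openGraph (labelledOpen ends z)).Reachable a s ∧ ¬ (openGraph (labelledOpen ends z)).Reachable a c ∧
          ¬ (openGraph (labelledOpen ends z)).Reachable s c) ∧
        (openGraph (labelledOpen ends (clusterFlip ends a fun l => !z l))).Reachable s c) =
      (univ.filter fun z : α → Bool =>
        (¬ (openGraph (labelledOpen ends z)).Reachable a s ∧ ¬ (openGraph (labelledOpen ends z)).Reachable a c) ∧
          (openGraph (labelledOpen ends (clusterFlip ends a fun l => !z l))).Reachable s c).filter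
        fun z => ¬ (openGraph (labelledOpen ends z)).Reachable s c := by
    ext z
    simp only [Finset.mem_filter, Finset.mem_univ, true_and]
    tauto
  have h2 : (univ.filter fun z : α → Bool =>
        ¬ (openGraph (labelledOpen ends z)).Reachable a s ∧ ¬ (openGraph (labelledOpen ends z)).Reachable a c ∧
          (openGraph (labelledOpen ends z)).Reachable s c) =
      (univ.filter fun z : α → Bool =>
        (¬ (openGraph (labelledOpen ends z)).Reachable a s ∧ ¬ (openGraph (labelledOpen ends z)).Reachable a c) ∧
          (openGraph (labelledOpen ends (clusterFlip ends a fun l => !z l))).Reachable s c).filter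
        fun z => ¬ ¬ (openGraph (labelledOpen ends z)).Reachable s c := by
    ext z
    simp only [Finset.mem_filter, Finset.mem_univ, true_and, not_not]
    constructor
    · rintro ⟨has, hac, hsc⟩
      exact ⟨⟨⟨has, hac⟩, reachable_flat_of_reachable ends a z has hsc⟩, hsc⟩
    · rintro ⟨⟨⟨has, hac⟩, _⟩, hsc⟩
      exact ⟨has, hac, hsc⟩
  rw [h1, h2, Finset.card_filter_add_card_filter_not]
  exact card_filter_flat_eq_card_filter_compl ends a
    (fun z => ¬ (openGraph (labelledOpen ends z)).Reachable a s ∧ ¬ (openGraph (labelledOpen ends z)).Reachable a c)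
    (fun w => (openGraph (labelledOpen ends w)).Reachable s c)
    (fun z z' h => by rw [h s, h c])

open Classical in
/-- `#bad` as a difference of two ♭-free counts. [this work] -/
theorem card_bad_eq_antithetic_sub (ends : α → Sym2 V) (a s c : V) :
    (univ.filter fun z : α → Bool =>
        (¬ (openGraph (labelledOpen ends z)).Reachable a s ∧ ¬ (openGraph (labelledOpen ends z)).Reachable a c ∧
          ¬ (openGraph (labelledOpen ends z)).Reachable s c) ∧
        (openGraph (labelledOpen ends (clusterFlip ends a fun l => !z l))).Reachable s c).card =
    (univ.filter fun w : α → Bool =>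
        (openGraph (labelledOpen ends w)).Reachable s c ∧
        (¬ (openGraph (labelledOpen ends fun l => !w l)).Reachable a s ∧
          ¬ (openGraph (labelledOpen ends fun l => !w l)).Reachable a c)).card -
    (univ.filter fun z : α → Bool =>
        ¬ (openGraph (labelledOpen ends z)).Reachable a s ∧ ¬ (openGraph (labelledOpen ends z)).Reachable a c ∧
          (openGraph (labelledOpen ends z)).Reachable s c).card := by
  have h := card_bad_add_card_eq_card_antithetic ends a s c
  omega

open Classical in
/-- **CONJECTURE (P) without ♭.**  The product form `#bad² ≤ #P1·#P2` is equivalent to the inequality between ♭-free counts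
`(#{w : s ↔_w c, a ↮_{w̄} s, a ↮_{w̄} c} − #{w : s ↔_w c, a ↮_w s, a ↮_w c})² ≤ #{a ↔ s, a ↮ c} · #{a ↔ c, a ↮ s}`. [this work] -/
theorem productForm_iff_antithetic (ends : α → Sym2 V) (a s c : V) :
    (univ.filter fun z : α → Bool =>
        (¬ (openGraph (labelledOpen ends z)).Reachable a s ∧ ¬ (openGraph (labelledOpen ends z)).Reachable a c ∧
          ¬ (openGraph (labelledOpen ends z)).Reachable s c) ∧
        (openGraph (labelledOpen ends (clusterFlip ends a fun l => !z l))).Reachable s c).card ^ 2 ≤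
    (univ.filter fun z : α → Bool =>
        (openGraph (labelledOpen ends z)).Reachable a s ∧ ¬ (openGraph (labelledOpen ends z)).Reachable a c).card *
    (univ.filter fun z : α → Bool =>
        (openGraph (labelledOpen ends z)).Reachable a c ∧ ¬ (openGraph (labelledOpen ends z)).Reachable a s).card ↔
    ((univ.filter fun w : α → Bool =>
        (openGraph (labelledOpen ends w)).Reachable s c ∧
        (¬ (openGraph (labelledOpen ends fun l => !w l)).Reachable a s ∧
          ¬ (openGraph (labelledOpen ends fun l => !w l)).Reachable a c)).card -
     (univ.filter fun z : α → Bool =>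
        ¬ (openGraph (labelledOpen ends z)).Reachable a s ∧ ¬ (openGraph (labelledOpen ends z)).Reachable a c ∧
          (openGraph (labelledOpen ends z)).Reachable s c).card) ^ 2 ≤
    (univ.filter fun z : α → Bool =>
        (openGraph (labelledOpen ends z)).Reachable a s ∧ ¬ (openGraph (labelledOpen ends z)).Reachable a c).card *
    (univ.filter fun z : α → Bool =>
        (openGraph (labelledOpen ends z)).Reachable a c ∧ ¬ (openGraph (labelledOpen ends z)).Reachable a s).card := by
  rw [card_bad_eq_antithetic_sub ends a s c]

end Antithetic

end Summit.CriticalPhenomena.PercolationContinuityZ3.Theorems.ProductFormFibre
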